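import Summits.Ventures.PercRepro.RankLevelSetGirthDoor
import Summits.Ventures.PercRepro.RankLevelSetDeleteMonoUnexposed

/-!
# PercRepro — THE DELETION PAYS THE EXPOSURE: a sufficient door at a girth point (night-1, gen 12)

The exact deletion increment of `RankLevelSetDeleteMonoUnexposed` (`Matroid.slack_sub_delete_eq`, rank `p + 1`):
`σ_M(p+1,q+1) − σ_{M ＼ e}(p+1,q+1) = σ_{M ／ e}(p,q) + (Φ(p,q) − Φ(p+1,q+1))·#U_{M ／ e}(p,q)
  + Φ(p+1,q+1)·(n⁰⁰_{p,q}(e) − n⁰⁰_{p,q+1}(e))`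
shows that the contraction door (MC″) `σ_{M ／ e}(p,q) ≤ σ_M(p+1,q+1)` holds at `e` as soon as the DELETION's slack
pays `Φ(p+1,q+1)` times the EXPOSURE `n⁰⁰_{p,q+1}(e) = freeCount M e p (q+1)` of `e` (the partitions of `E ∖ e` into a
rank-`p` and a rank-`(q+1)` side in the closure of neither of which `e` lies): the other two terms are non-negative
(`phiK_succ_succ_le`).  Census (own exact code; dossier §22.8): this DELETION-PAYS door holds at EVERY girth point of
every simple coloop-free core with ≤ 9 elements and of all 146,841,804 core-cells on 10 elements (kit j252013:
901,315,702 girth points, 0 failures; it fails at 999 non-girth points there).  At the FIRST layer `|E| = p + q + 1`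
the deletion lies on the tight layer, where its slack is Theorem M's explicit surplus — so the door is a fully
explicit inequality in `M` there.

* **`Matroid.slack_contract_le_of_delete_pays`** — DELETION-PAYS at `e` ⇒ (MC″) at `e` (pure algebra on the identity);
* `ThmN.DelPaysGirthCore` — every simple coloop-free core above the tight layer has a girth point at which the
  deletion pays the exposure: `Φ(p,q)·n⁰⁰_{p−1,q}(e) ≤ σ_{M ＼ e}(p,q)`;
* `ThmN.girthContractDoorCore_of_delPaysGirthCore`, **`ThmN.c025_of_delPaysGirthCore : DelPaysGirthCore → C025`**.
Axioms: standard.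
-/

open scoped Matroid

namespace PercRepro

open Set

namespace Matroid

variable {α : Type} {M : _root_.Matroid α} [M.Finite] {e : α}

/-- **DELETION PAYS ⇒ (MC″)**: if `σ_{M ＼ e}(p+1,q+1) ≥ Φ(p+1,q+1)·n⁰⁰_{p,q+1}(e)` then
`σ_{M ／ e}(p,q) ≤ σ_M(p+1,q+1)` (rank `p + 1`, `e` a non-loop). -/
theorem slack_contract_le_of_delete_pays (he : M.Indep {e}) {p : ℕ} (hR : M.eRank = ((p + 1 : ℕ) : ℕ∞)) (q : ℕ)
    (hpay : phiK (p + 1) (q + 1) * (freeCount M e p (q + 1) : ℚ) ≤ slack (M ＼ {e}) (p + 1) (q + 1)) :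
    slack (M ／ {e}) p q ≤ slack M (p + 1) (q + 1) := by
  have hid := slack_sub_delete_eq he hR q
  have hphi : phiK (p + 1) (q + 1) ≤ phiK p q := phiK_succ_succ_le p q
  have hphi0 : 0 ≤ phiK (p + 1) (q + 1) := by unfold phiK; positivity
  have hU0 : (0 : ℚ) ≤ (topCount (M ／ {e}) p q : ℚ) := by positivity
  have hf0 : (0 : ℚ) ≤ (freeCount M e p q : ℚ) := by positivity
  have h1 : 0 ≤ (phiK p q - phiK (p + 1) (q + 1)) * (topCount (M ／ {e}) p q : ℚ) :=
    mul_nonneg (sub_nonneg.2 hphi) hU0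
  have h2 : 0 ≤ phiK (p + 1) (q + 1) * (freeCount M e p q : ℚ) := mul_nonneg hphi0 hf0
  nlinarith [hid, h1, h2, hpay]

end Matroid

namespace ThmN

variable {α : Type}

/-- **DELETION PAYS THE EXPOSURE AT A GIRTH POINT, on cores**: on every simple, rank-`p`, coloop-free core with every
element `e`-free-partitioned, `q ≥ 1`, `q + 2 ≤ p`, `|E| > p + q`, SOME girth point `e` satisfies
`Φ(p,q)·n⁰⁰_{p−1,q}(e) ≤ σ_{M ＼ e}(p,q)`. -/
def DelPaysGirthCore : Prop :=
  ∀ {α : Type} (M : Matroid α) [M.Finite] (p q : ℕ), 1 ≤ q → q + 2 ≤ p →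
    (∀ e ∈ M.E, ∀ f ∈ M.E, e ≠ f → M.eRk {e, f} = 2) → M.eRank = (p : ℕ∞) →
    (∀ e, ¬ M.IsColoop e) →
    (∀ e ∈ M.E, ∃ A ⊆ M.E \ {e}, e ∉ M.closure A ∧ e ∉ M.closure ((M.E \ {e}) \ A)) →
    p + q < M.E.ncard →
    ∃ e ∈ M.E, IsGirthPoint M e ∧
      phiK p q * (Matroid.freeCount M e (p - 1) q : ℚ) ≤ Matroid.slack (M ＼ {e}) p q

/-- In a simple core above the tight layer (`|E| > p + q ≥ 3`) every element is a non-loop. -/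
theorem indep_singleton_of_simple (M : Matroid α) [M.Finite] {p q : ℕ} (hq : 1 ≤ q) (hpq : q + 2 ≤ p)
    (hs : ∀ e ∈ M.E, ∀ f ∈ M.E, e ≠ f → M.eRk {e, f} = 2) (hbig : p + q < M.E.ncard)
    {e : α} (he : e ∈ M.E) : M.Indep {e} := by
  classical
  -- a second element exists
  have h2 : 2 ≤ M.E.ncard := by omega
  obtain ⟨f, hf, hfe⟩ : ∃ f ∈ M.E, f ≠ e := by
    by_contra hcon
    push Not at hcon
    have hsub : M.E ⊆ {e} := fun x hx => by
      rw [Set.mem_singleton_iff]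
      exact hcon x hx
    have := Set.ncard_le_ncard hsub (Set.finite_singleton e)
    rw [Set.ncard_singleton] at this
    omega
  have hrk := hs e he f hf (Ne.symm hfe)
  have hpair : M.Indep {e, f} := by
    rw [_root_.Matroid.indep_iff_eRk_eq_encard_of_finite (Set.toFinite _), hrk, Set.encard_pair (Ne.symm hfe)]
  exact hpair.subset (Set.singleton_subset_iff.2 (Set.mem_insert e {f}))

/-- DELETION-PAYS at a girth point gives the girth contraction door. -/
theorem girthContractDoorCore_of_delPaysGirthCore (h : DelPaysGirthCore) : GirthContractDoorCore := by
  intro α M _ p q hq hpq hs hR hC hU hbig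
  obtain ⟨e, he, hg, hpay⟩ := h M p q hq hpq hs hR hC hU hbig
  refine ⟨e, he, hg, ?_⟩
  have heI : M.Indep {e} := indep_singleton_of_simple M hq hpq hs hbig he
  obtain ⟨p', rfl⟩ : ∃ p', p = p' + 1 := ⟨p - 1, by omega⟩
  obtain ⟨q', rfl⟩ : ∃ q', q = q' + 1 := ⟨q - 1, by omega⟩
  simp only [Nat.add_sub_cancel] at hpay ⊢
  exact Matroid.slack_contract_le_of_delete_pays heI hR q' hpay

/-- **C-025 FROM DELETION-PAYS AT A GIRTH POINT.** -/
theorem c025_of_delPaysGirthCore (h : DelPaysGirthCore) : C025 :=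
  c025_of_girthContractDoorCore (girthContractDoorCore_of_delPaysGirthCore h)

end ThmN

end PercRepro
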